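import Mathlib
import Literature.NumberTheory.Automorphic.ResolventKernels
import Literature.NumberTheory.Automorphic.FuchsianPseudoCuspForms
import Literature.NumberTheory.Automorphic.FuchsianEisensteinTails

/-!
# Meromorphic continuation of the Eisenstein series, I: the resolvent construction and its
non-degeneracy (Iwaniec, *Spectral Methods of Automorphic Forms*, GSM 53, §6.1–6.2 (6.5)–(6.18);
PDF pp. 82–85 — by the method of Colin de Verdière, *Pseudo-laplaciens II*, in resolvent form)

Twentieth brick of the general-`Γ` Eisenstein series, fourth file of **Chapter 6 (meromorphic
continuation of `E_𝔞(z, s)`)** for a general finite-volume group with a complete system of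
inequivalent cusps `𝔞ᵢ = σᵢ ∞` (towards `Iwaniec2002_eq_12_5` / `Iwaniec2002_thm_12_1` through
`Fuchsian.SpectralParts`). Everything is PROVED; no fact is introduced.

**The method.** Iwaniec (§6.1–6.2) continues `E_𝔞(z, s)` through the Fredholm theory of the
inhomogeneous equation obtained from the resolvent (Green function) of `Δ`; we run the same scheme
with the compact self-adjoint operator `T^Y_k = P_Y T_k P_Y` of `FuchsianPseudoCuspForms` (`T_k` the
invariant integral operator of a resolvent kernel `k` (`ResolventKernels`), `P_Y` the projection
onto the pseudo-cusp forms `L²_Y`, after Colin de Verdière / Lax–Phillips) in place of the Green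
function, and the resolvent `R(μ) = (μ - T^Y_k)⁻¹` — meromorphic on `ℂ ∖ {0}`
(`Literature.Analysis.OperatorTheory.CompactSelfAdjointResolvent`) — in place of Fredholm
determinants. For `Re s > 1` (`FuchsianEisensteinTails`):
`E_𝔞ᵢ(·, s) = E^Y(·, s) + θᵢ^s + Σⱼ φᵢⱼ(s) θⱼ^{1-s}` and
`(L_k - ĥ_k(s)) E^Y(s) + aᵢ^s + Σⱼ φᵢⱼ(s) aⱼ^{1-s} = 0` with ENTIRE `L²` sources `[aⱼ^w]`. On the
strip `S_k` (`ĥ_k ≠ 0`):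

1. (§2) `src none s = [aᵢ^s]`, `src (some j) s = [aⱼ^{1-s}]`; the resolvent parts
   `vPart o s = R(ĥ_k(s)) P_Y src_o(s) ∈ L²_Y`; the residuals
   `rPart o s = (T_k - ĥ_k(s)) ι vPart_o(s) + src_o(s) ∈ L²(F)`; the Gram system
   `gramM s = (⟪rₘ(s₀), rⱼ(s)⟫)ₘⱼ`, `cvec s = (-⟪rₘ(s₀), r_none(s)⟫)ₘ`; the raw continuations
   `phiRaw s = (gramM s)⁻¹ cvec s` (the scattering row), `vRaw s = v_none + Σⱼ phiRaw_j vⱼ`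
   (the truncated Eisenstein series in `L²_Y`), `resid` (the total residual).
2. (§3) All of these are MEROMORPHIC on the strip (`meromorphicAt_resolvent_comp`: the resolvent of a
   compact self-adjoint operator composed with the analytic non-vanishing `ĥ_k`; Cramer), and
   analytic where `ĥ_k(s) ∈ ρ(T^Y_k)`.
3. (§4) **Non-degeneracy at `s₀ = 2 + i/2`.** `(T_k - ĥ_k(w))[θⱼ^w] = [aⱼ^w]` in `L²(F)` for the
   bounded tails `Re w ≤ 0` (`kernelCLM_tailEis_sub_smul`); **the residuals `r₁(s₀), …, r_h(s₀)` are
   linearly independent** (`linearIndependent_rPart_baseParam`): if `Σ gⱼ rⱼ(s₀) = 0` then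
   `u = ι(Σ gⱼ vⱼ(s₀)) + Σ gⱼ [θⱼ^{1-s₀}]` is an eigenvector of the self-adjoint `T_k` with the
   non-real eigenvalue `ĥ_k(s₀)`, so `u = 0`, so `Σ gⱼ [θⱼ^{1-s₀}]` is a pseudo-cusp form, whose
   constant term at `𝔞ₘ` above `Y` is `gₘ y^{1-s₀}` on a set of positive measure — `g = 0`.
   Hence `det gramM(s₀) ≠ 0` (`Matrix.det_gram_ne_zero_iff_linearIndependent`), the `P_Y`-free
   eigenvalue `ĥ_k(s)` is in `ρ(T^Y_k)` whenever non-real, and on a ball around `s₀` everything is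
   regular: strip, `Re s > 1`, `Im ĥ_k(s) ≠ 0`, `det gramM(s) ≠ 0` (`exists_ball_baseParam`).

The identification with the Eisenstein data on `Re s > 1` and the normal forms follow in
`FuchsianEisensteinContinuation`.

## References
* [Iwaniec2002] H. Iwaniec, *Spectral Methods of Automorphic Forms*, 2nd ed., GSM 53, AMS 2002,
  §6.1–6.2, (6.5)–(6.18), PDF pp. 82–85; Thm 1.16 & (1.62), PDF p. 24
  (held copy `book:iwaniec2002-spectral-methods-automorphic-forms`).
* [Colindeverdiere1983] Y. Colin de Verdière, *Pseudo-laplaciens II*, Ann. Inst. Fourier 33 (1983)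
  87–113 (continuing `E` through the resolvent of an operator built from truncation in the cusps).
* [Garrett2018] P. Garrett, *Modern Analysis of Automorphic Forms by Example*, vol. 1, CUP 2018,
  §1.10–1.11, §1.15 (statements; held copy).

Mathlib: `resolvent`, `resolventSet`, `Matrix.det_gram_ne_zero_iff_linearIndependent`,
`Fintype.linearIndependent_iff`, `MeasureTheory.ae_iff`, `Lp.coeFn_fun_finsetSum`. Literature:
`pseudoCuspSubmodule`, `pseudoCuspKernelCLM`, `isSelfAdjoint_pseudoCuspKernelCLM`,
`isCompactOperator_pseudoCuspKernelCLM`, `mem_pseudoCuspSubmodule_iff` (`FuchsianPseudoCuspForms`); `kernelCLM`,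
`kernelCLM_coeFn`, `kernelOp_eq_invariantOperator`, `isSelfAdjoint_kernelCLM`, `autExt_congr_ae`,
`autExt_ae_eq_of_isAutomorphic`, `cuspMeanAt_congr_ae` (`FuchsianCuspFormsCompact`, `FuchsianMaassCuspForms`,
`FuchsianCuspidalSubspace`); `tailEis`, `tailDefect`, `tailDefectLp`, `memLp_tailDefect`, `analyticOnNhd_tailDefectLp`,
`norm_incEisCusp_cutHigh_le`, `incEisCusp_cutHigh_horocycle`, `isAutomorphic_tailEis`, `measurable_tailEis`
(`FuchsianEisensteinTails`, `FuchsianEisensteinTruncationPairings`); `RKernel`, `baseParam`, the matrix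
meromorphy lemmas (`ResolventKernels`); `eigenvalueFn`, `selbergTransform_neg` (`SelbergTransformStrip`,
`SelbergTransform`); `meromorphicAt_resolvent_comp`, `analyticAt_resolvent_apply`,
`eq_zero_of_apply_eq_smul_of_im_ne_zero`, `mem_resolventSet_of_im_ne_zero`
(`Literature.Analysis.OperatorTheory.CompactSelfAdjointResolvent`); `cuspStrip`, `volume_cuspStrip`,
`cuspMeanAt_apply` (`FuchsianCuspidalSubspace`).
-/

noncomputable section

namespace Literature.NumberTheory.Automorphic

open _root_.MeasureTheory _root_.Set _root_.Filter _root_.Real _root_.Topology _root_.Metric _root_.UpperHalfPlane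
open _root_.Literature.Analysis.OperatorTheory.CompactResolvent
open scoped _root_.ENNReal _root_.NNReal _root_.MatrixGroups _root_.Pointwise _root_.InnerProductSpace _root_.Matrix

namespace Fuchsian

variable {Γ : Subgroup (GL (Fin 2) ℝ)} {F : Set ℍ} {h : ℕ} {𝔞 : Fin h → OnePoint ℝ} {σ : Fin h → SL(2, ℝ)}

/-! ## 2. The construction: resolvent parts, residuals, the Gram system, the raw continuations -/

section Construction

variable (hΓ : Γ ≤ (Matrix.SpecialLinearGroup.toGL : SL(2, ℝ) →* GL (Fin 2) ℝ).range)
  (hneg : (-1 : GL (Fin 2) ℝ) ∈ Γ) (hd : IsDiscreteSubgroup Γ) (hF : IsHypFundamentalDomain Γ F)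
  (σ : Fin h → SL(2, ℝ)) (κ : RKernel) (Y : ℝ)

/-- **The compact self-adjoint operator `T^Y_k`** of the kernel on the pseudo-cusp forms. [folklore] -/
abbrev TY : pseudoCuspSubmodule hΓ hneg hd hF σ Y →L[ℂ] pseudoCuspSubmodule hΓ hneg hd hF σ Y :=
  pseudoCuspKernelCLM hΓ hneg hd hF σ Y κ.test κ.lip.continuous

/-- **`T_k` on `L²(F)`** for the kernel. [folklore] -/
abbrev Tk : Lp ℂ 2 (volume.restrict F) →L[ℂ] Lp ℂ 2 (volume.restrict F) :=
  kernelCLM hΓ hneg hd hF κ.test κ.lip.continuous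

variable (Γ F) in
/-- **The sources**: `src i none s = [aᵢ^s]` (the defect of the `δ`-tail) and
`src i (some j) s = [aⱼ^{1-s}]` (the defects of the `φ`-tails). [cite: Iwaniec2002, §6.1 (6.6), PDF p. 83] -/
def src (i : Fin h) : Option (Fin h) → ℂ → Lp ℂ 2 (volume.restrict F)
  | none, s => tailDefectLp Γ F σ κ.k i s Y
  | some j, s => tailDefectLp Γ F σ κ.k j (1 - s) Y

/-- **The resolvent parts** `v_o(s) = R_{T^Y}(ĥ(s)) P_Y src_o(s)` — so that
`E^Y(s) = v_none(s) + Σⱼ φᵢⱼ(s) v_{some j}(s)` for `Re s > 1`. [cite: Iwaniec2002, §6.2 (6.10), PDF p. 84] -/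
def vPart (i : Fin h) (o : Option (Fin h)) (s : ℂ) : pseudoCuspSubmodule hΓ hneg hd hF σ Y :=
  resolvent (TY hΓ hneg hd hF σ κ Y) (eigenvalueFn κ.k s)
    ((pseudoCuspSubmodule hΓ hneg hd hF σ Y).orthogonalProjectionOnto (src Γ F σ κ Y i o s))

/-- **The residuals** `r_o(s) = (T_k - ĥ(s)) v_o(s) + src_o(s) ∈ L²(F)` (their `P_Y`-components vanish
by construction; the Eisenstein data make `r_none + Σⱼ φᵢⱼ r_{some j}` vanish entirely). [folklore] -/
def rPart (i : Fin h) (o : Option (Fin h)) (s : ℂ) : Lp ℂ 2 (volume.restrict F) :=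
  Tk hΓ hneg hd hF κ ((vPart hΓ hneg hd hF σ κ Y i o s : pseudoCuspSubmodule hΓ hneg hd hF σ Y) : Lp ℂ 2 (volume.restrict F))
    - eigenvalueFn κ.k s • ((vPart hΓ hneg hd hF σ κ Y i o s : pseudoCuspSubmodule hΓ hneg hd hF σ Y) : Lp ℂ 2 (volume.restrict F))
    + src Γ F σ κ Y i o s

/-- **The Gram system**: `G(s)ₘⱼ = ⟪rₘ(s₀), rⱼ(s)⟫`. [folklore] -/
def gramM (i : Fin h) (s : ℂ) : Matrix (Fin h) (Fin h) ℂ :=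
  Matrix.of fun m j => ⟪rPart hΓ hneg hd hF σ κ Y i (some m) baseParam, rPart hΓ hneg hd hF σ κ Y i (some j) s⟫_ℂ

/-- The right side `c(s)ₘ = -⟪rₘ(s₀), r_none(s)⟫`. [folklore] -/
def cvec (i : Fin h) (s : ℂ) : Fin h → ℂ :=
  fun m => -⟪rPart hΓ hneg hd hF σ κ Y i (some m) baseParam, rPart hΓ hneg hd hF σ κ Y i none s⟫_ℂ

/-- **The raw continued scattering row** `φ⃗(s) = G(s)⁻¹ c(s)` (Cramer). [cite: Iwaniec2002, §6.2 (after (6.18): "we also obtain the meromorphic continuation of the coefficients `φ_𝔞𝔟(s)`"), PDF p. 85] -/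
def phiRaw (i : Fin h) (s : ℂ) : Fin h → ℂ :=
  (gramM hΓ hneg hd hF σ κ Y i s)⁻¹ *ᵥ cvec hΓ hneg hd hF σ κ Y i s

/-- **The raw continued truncated Eisenstein series** `v(s) = v_none(s) + Σⱼ φⱼ(s) v_{some j}(s) ∈ L²_Y`.
[cite: Iwaniec2002, §6.2 (6.10) & (6.15), PDF pp. 84–85] -/
def vRaw (i : Fin h) (s : ℂ) : pseudoCuspSubmodule hΓ hneg hd hF σ Y :=
  vPart hΓ hneg hd hF σ κ Y i none s + ∑ j, phiRaw hΓ hneg hd hF σ κ Y i s j • vPart hΓ hneg hd hF σ κ Y i (some j) s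

/-- **The total residual** `r(s) = r_none(s) + Σⱼ φⱼ(s) r_{some j}(s)`. [folklore] -/
def resid (i : Fin h) (s : ℂ) : Lp ℂ 2 (volume.restrict F) :=
  rPart hΓ hneg hd hF σ κ Y i none s + ∑ j, phiRaw hΓ hneg hd hF σ κ Y i s j • rPart hΓ hneg hd hF σ κ Y i (some j) s

end Construction

/-! ## 3. Meromorphy on the strip -/

section Meromorphy

variable (hΓ : Γ ≤ (Matrix.SpecialLinearGroup.toGL : SL(2, ℝ) →* GL (Fin 2) ℝ).range)
  (hneg : (-1 : GL (Fin 2) ℝ) ∈ Γ) (hd : IsDiscreteSubgroup Γ) (hF : IsHypFundamentalDomain Γ F)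
  (hvol : volume F < ⊤)
  (hinfty : ∀ i, (Matrix.SpecialLinearGroup.toGL (σ i) : GL (Fin 2) ℝ) • (OnePoint.infty : OnePoint ℝ) = 𝔞 i)
  (hper : ∀ i, (ConjAct.toConjAct (Matrix.SpecialLinearGroup.toGL (σ i) : GL (Fin 2) ℝ)⁻¹ • Γ).strictPeriods =
    AddSubgroup.zmultiples 1)
  (hineq : ∀ i j, ∀ γ ∈ Γ, γ • 𝔞 i = 𝔞 j → i = j)
  (hcomplete : ∀ c : OnePoint ℝ, IsCusp c Γ → ∃ i, ∃ γ ∈ Γ, γ • 𝔞 i = c)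
  (κ : RKernel) {Y : ℝ} (hY : 1 ≤ Y)

include hΓ hneg hd hvol hinfty hper hineq hY in
/-- **The sources are entire.** [folklore] -/
theorem analyticAt_src (i : Fin h) (o : Option (Fin h)) (s : ℂ) :
    AnalyticAt ℂ (src Γ F σ κ Y i o) s := by
  cases o with
  | none =>
    exact analyticOnNhd_tailDefectLp hΓ hneg hd hvol hinfty hper hineq κ.test κ.lip κ.bound κ.supp i hY s (mem_univ _)
  | some j =>
    have h1 := analyticOnNhd_tailDefectLp (F := F) hΓ hneg hd hvol hinfty hper hineq κ.test κ.lip κ.bound κ.supp j hY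
    have h2 : AnalyticAt ℂ (fun s : ℂ => 1 - s) s := analyticAt_const.sub analyticAt_id
    exact (h1 (1 - s) (mem_univ _)).comp h2

include hvol hinfty hper hineq hcomplete in
/-- `T^Y_k` is self-adjoint and compact. [folklore] -/
theorem isSelfAdjoint_and_isCompactOperator_TY (Y : ℝ) :
    IsSelfAdjoint (TY hΓ hneg hd hF σ κ Y) ∧ IsCompactOperator (TY hΓ hneg hd hF σ κ Y) :=
  ⟨isSelfAdjoint_pseudoCuspKernelCLM hΓ hneg hd hF σ Y κ.test κ.lip.continuous,
    isCompactOperator_pseudoCuspKernelCLM hΓ hneg hd hF hvol hinfty hper hineq hcomplete κ.test κ.lip κ.supp Y⟩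

include hvol hinfty hper hineq hcomplete hY in
/-- **The resolvent parts are meromorphic on the strip** (`meromorphicAt_resolvent_comp`: compact
self-adjoint `T^Y_k`, analytic non-vanishing `ĥ_k`, analytic sources). [cite: Iwaniec2002, §6.2 (6.9)–(6.10), PDF p. 84] -/
theorem meromorphicOn_vPart (i : Fin h) (o : Option (Fin h)) :
    MeromorphicOn (vPart hΓ hneg hd hF σ κ Y i o) κ.strip := by
  intro s hs
  obtain ⟨hsa, hc⟩ := isSelfAdjoint_and_isCompactOperator_TY hΓ hneg hd hF hvol hinfty hper hineq hcomplete κ Y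
  unfold vPart
  exact meromorphicAt_resolvent_comp hsa hc (κ.analyticAt_eigenvalueFn s) (κ.eigenvalueFn_ne_zero hs)
    (((pseudoCuspSubmodule hΓ hneg hd hF σ Y).orthogonalProjectionOnto).comp_analyticAt'
      (analyticAt_src hΓ hneg hd hvol hinfty hper hineq κ hY i o s))

include hvol hinfty hper hineq hY in
/-- **Where `ĥ_k(s)` is in the resolvent set of `T^Y_k` the resolvent parts are analytic.** [folklore] -/
theorem analyticAt_vPart {s : ℂ} (hs : eigenvalueFn κ.k s ∈ resolventSet ℂ (TY hΓ hneg hd hF σ κ Y))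
    (i : Fin h) (o : Option (Fin h)) : AnalyticAt ℂ (vPart hΓ hneg hd hF σ κ Y i o) s := by
  unfold vPart
  exact analyticAt_resolvent_apply (κ.analyticAt_eigenvalueFn s)
    (((pseudoCuspSubmodule hΓ hneg hd hF σ Y).orthogonalProjectionOnto).comp_analyticAt'
      (analyticAt_src hΓ hneg hd hvol hinfty hper hineq κ hY i o s)) hs

include hvol hinfty hper hineq hcomplete hY in
/-- The residuals are meromorphic on the strip. [folklore] -/
theorem meromorphicOn_rPart (i : Fin h) (o : Option (Fin h)) :
    MeromorphicOn (rPart hΓ hneg hd hF σ κ Y i o) κ.strip := by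
  intro s hs
  have hv := meromorphicOn_vPart hΓ hneg hd hF hvol hinfty hper hineq hcomplete κ hY i o s hs
  have hι : MeromorphicAt (fun z => ((vPart hΓ hneg hd hF σ κ Y i o z : pseudoCuspSubmodule hΓ hneg hd hF σ Y) :
      Lp ℂ 2 (volume.restrict F))) s :=
    (pseudoCuspSubmodule hΓ hneg hd hF σ Y).subtypeL.comp_meromorphicAt hv
  unfold rPart
  exact (((Tk hΓ hneg hd hF κ).comp_meromorphicAt hι).sub ((κ.analyticAt_eigenvalueFn s).meromorphicAt.smul hι)).add
    (analyticAt_src hΓ hneg hd hvol hinfty hper hineq κ hY i o s).meromorphicAt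

include hvol hinfty hper hineq hY in
/-- … and analytic where `ĥ_k(s) ∈ ρ(T^Y_k)`. [folklore] -/
theorem analyticAt_rPart {s : ℂ} (hs : eigenvalueFn κ.k s ∈ resolventSet ℂ (TY hΓ hneg hd hF σ κ Y))
    (i : Fin h) (o : Option (Fin h)) : AnalyticAt ℂ (rPart hΓ hneg hd hF σ κ Y i o) s := by
  have hv := analyticAt_vPart hΓ hneg hd hF hvol hinfty hper hineq κ hY hs i o
  have hι : AnalyticAt ℂ (fun z => ((vPart hΓ hneg hd hF σ κ Y i o z : pseudoCuspSubmodule hΓ hneg hd hF σ Y) :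
      Lp ℂ 2 (volume.restrict F))) s :=
    (pseudoCuspSubmodule hΓ hneg hd hF σ Y).subtypeL.comp_analyticAt' hv
  unfold rPart
  exact (((Tk hΓ hneg hd hF κ).comp_analyticAt' hι).sub ((κ.analyticAt_eigenvalueFn s).smul hι)).add
    (analyticAt_src hΓ hneg hd hvol hinfty hper hineq κ hY i o s)

include hvol hinfty hper hineq hcomplete hY in
/-- The entries of the Gram system and its right side are meromorphic on the strip. [folklore] -/
theorem meromorphicOn_gramM_apply (i : Fin h) (m j : Fin h) :
    MeromorphicOn (fun s => gramM hΓ hneg hd hF σ κ Y i s m j) κ.strip := fun s hs => by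
  unfold gramM
  simp only [Matrix.of_apply]
  exact MeromorphicAt.inner_const_left _ (meromorphicOn_rPart hΓ hneg hd hF hvol hinfty hper hineq hcomplete κ hY i _ s hs)

include hvol hinfty hper hineq hcomplete hY in
/-- … and the right side. [folklore] -/
theorem meromorphicOn_cvec_apply (i : Fin h) (m : Fin h) :
    MeromorphicOn (fun s => cvec hΓ hneg hd hF σ κ Y i s m) κ.strip := fun s hs => by
  unfold cvec
  exact (MeromorphicAt.inner_const_left _ (meromorphicOn_rPart hΓ hneg hd hF hvol hinfty hper hineq hcomplete κ hY i _ s hs)).neg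

include hvol hinfty hper hineq hY in
/-- Analytic versions at points where `ĥ_k(s) ∈ ρ(T^Y_k)`. [folklore] -/
theorem analyticAt_gramM_apply {s : ℂ} (hs : eigenvalueFn κ.k s ∈ resolventSet ℂ (TY hΓ hneg hd hF σ κ Y))
    (i m j : Fin h) : AnalyticAt ℂ (fun s => gramM hΓ hneg hd hF σ κ Y i s m j) s := by
  unfold gramM
  simp only [Matrix.of_apply]
  exact AnalyticAt.inner_const_left _ (analyticAt_rPart hΓ hneg hd hF hvol hinfty hper hineq κ hY hs i _)

include hvol hinfty hper hineq hcomplete hY in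
/-- **The components of the raw continued scattering row are meromorphic on the strip.**
[cite: Iwaniec2002, §6.2, PDF p. 85] -/
theorem meromorphicOn_phiRaw_apply (i j : Fin h) :
    MeromorphicOn (fun s => phiRaw hΓ hneg hd hF σ κ Y i s j) κ.strip := fun s hs => by
  unfold phiRaw
  exact MeromorphicAt.matrix_inv_mulVec
    (fun m j => meromorphicOn_gramM_apply hΓ hneg hd hF hvol hinfty hper hineq hcomplete κ hY i m j s hs)
    (fun m => meromorphicOn_cvec_apply hΓ hneg hd hF hvol hinfty hper hineq hcomplete κ hY i m s hs) j

include hvol hinfty hper hineq hcomplete hY in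
/-- **The raw continued truncated Eisenstein series is meromorphic on the strip** (`L²_Y`-valued).
[cite: Iwaniec2002, §6.2 (6.10) & Prop. 6.1 (6.15), PDF pp. 84–85] -/
theorem meromorphicOn_vRaw (i : Fin h) : MeromorphicOn (vRaw hΓ hneg hd hF σ κ Y i) κ.strip := fun s hs => by
  unfold vRaw
  refine (meromorphicOn_vPart hΓ hneg hd hF hvol hinfty hper hineq hcomplete κ hY i none s hs).add ?_
  refine MeromorphicAt.fun_sum fun j _ => ?_
  exact (meromorphicOn_phiRaw_apply hΓ hneg hd hF hvol hinfty hper hineq hcomplete κ hY i j s hs).smul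
    (meromorphicOn_vPart hΓ hneg hd hF hvol hinfty hper hineq hcomplete κ hY i (some j) s hs)

include hvol hinfty hper hineq hcomplete hY in
/-- The total residual is meromorphic on the strip. [folklore] -/
theorem meromorphicOn_resid (i : Fin h) : MeromorphicOn (resid hΓ hneg hd hF σ κ Y i) κ.strip := fun s hs => by
  unfold resid
  refine (meromorphicOn_rPart hΓ hneg hd hF hvol hinfty hper hineq hcomplete κ hY i none s hs).add ?_
  refine MeromorphicAt.fun_sum fun j _ => ?_
  exact (meromorphicOn_phiRaw_apply hΓ hneg hd hF hvol hinfty hper hineq hcomplete κ hY i j s hs).smul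
    (meromorphicOn_rPart hΓ hneg hd hF hvol hinfty hper hineq hcomplete κ hY i (some j) s hs)

end Meromorphy

/-! ## 4. The Gram system is non-degenerate: linear independence of the residuals at `s₀` -/

section Independence

variable (hΓ : Γ ≤ (Matrix.SpecialLinearGroup.toGL : SL(2, ℝ) →* GL (Fin 2) ℝ).range)
  (hneg : (-1 : GL (Fin 2) ℝ) ∈ Γ) (hd : IsDiscreteSubgroup Γ) (hF : IsHypFundamentalDomain Γ F)
  (hvol : volume F < ⊤)
  (hinfty : ∀ i, (Matrix.SpecialLinearGroup.toGL (σ i) : GL (Fin 2) ℝ) • (OnePoint.infty : OnePoint ℝ) = 𝔞 i)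
  (hper : ∀ i, (ConjAct.toConjAct (Matrix.SpecialLinearGroup.toGL (σ i) : GL (Fin 2) ℝ)⁻¹ • Γ).strictPeriods =
    AddSubgroup.zmultiples 1)
  (hineq : ∀ i j, ∀ γ ∈ Γ, γ • 𝔞 i = 𝔞 j → i = j)
  (hcomplete : ∀ c : OnePoint ℝ, IsCusp c Γ → ∃ i, ∃ γ ∈ Γ, γ • 𝔞 i = c)
  (κ : RKernel) {Y : ℝ} (hY : 1 ≤ Y)

/-- `ĥ_k(1 - s) = ĥ_k(s)` (`h` is even). [cite: Iwaniec2002, (1.62), PDF p. 24] -/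
theorem eigenvalueFn_one_sub (k : ℝ → ℝ) (s : ℂ) : eigenvalueFn k (1 - s) = eigenvalueFn k s := by
  unfold eigenvalueFn
  have : -Complex.I * (1 - s - 1 / 2) = -(-Complex.I * (s - 1 / 2)) := by ring
  rw [this, selbergTransform_neg]

include hΓ hd hvol hper in
/-- **The tails with `Re w ≤ 0` are bounded, hence square-integrable on `F`.** [folklore] -/
theorem memLp_tailEis_of_re_nonpos (j : Fin h) {w : ℂ} (hw : w.re ≤ 0) (hY : 1 ≤ Y) :
    MemLp (tailEis Γ σ j w Y) 2 (volume.restrict F) := by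
  haveI : IsFiniteMeasure (volume.restrict F) := isFiniteMeasure_restrict.mpr hvol.ne
  have hY0 : 0 < Y := by linarith
  exact MemLp.of_bound (measurable_tailEis hΓ hd hper j w hY0).aestronglyMeasurable _
    (Eventually.of_forall (norm_incEisCusp_cutHigh_le hΓ hd hper j hw hY0))

include hΓ hneg hd hF in
/-- **`T_k` on the class of an automorphic `L²` function `G` is represented by `L_k G`.** [folklore] -/
theorem kernelCLM_toLp_coeFn_of_isAutomorphic {k : ℝ → ℝ} (hk : IsTestKernel k) (hkc : Continuous k) {G : ℍ → ℂ}
    (hGa : IsAutomorphic Γ G) (hG : MemLp G 2 (volume.restrict F)) :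
    (kernelCLM hΓ hneg hd hF hk hkc (hG.toLp G) : ℍ → ℂ) =ᵐ[volume.restrict F] invariantOperator k G := by
  have h1 := kernelCLM_coeFn hΓ hneg hd hF hk hkc (hG.toLp G)
  have h2 : ∀ z, kernelOp Γ F k (hG.toLp G) z = invariantOperator k G z := by
    intro z
    rw [kernelOp_eq_invariantOperator hΓ hneg hd hF hk (Lp.memLp _) z]
    refine invariantOperator_congr_ae ?_ z
    exact (autExt_congr_ae hΓ hneg hd hF (MemLp.coeFn_toLp hG)).trans (autExt_ae_eq_of_isAutomorphic hΓ hneg hd hF hGa)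
  filter_upwards [h1] with z hz
  rw [hz, h2 z]

include hΓ hneg hd hF hvol hinfty hper hineq hY in
/-- **`(T_k - ĥ_k(w)) [θⱼ^w] = [aⱼ^w]`** in `L²(F)` for the bounded tails (`Re w ≤ 0`). [folklore] -/
theorem kernelCLM_tailEis_sub_smul (j : Fin h) {w : ℂ}
    (hmem : MemLp (tailEis Γ σ j w Y) 2 (volume.restrict F)) :
    Tk hΓ hneg hd hF κ (hmem.toLp _) - eigenvalueFn κ.k w • hmem.toLp _ = tailDefectLp Γ F σ κ.k j w Y := by
  have hmemD := memLp_tailDefect (F := F) hΓ hneg hd hvol hinfty hper hineq κ.test κ.lip κ.bound κ.supp j w hY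
  rw [tailDefectLp_eq_toLp hmemD]
  refine Lp.ext ?_
  filter_upwards [Lp.coeFn_sub (Tk hΓ hneg hd hF κ (hmem.toLp _)) (eigenvalueFn κ.k w • hmem.toLp _),
    Lp.coeFn_smul (eigenvalueFn κ.k w) (hmem.toLp _), MemLp.coeFn_toLp hmem, MemLp.coeFn_toLp hmemD,
    kernelCLM_toLp_coeFn_of_isAutomorphic hΓ hneg hd hF κ.test κ.lip.continuous (isAutomorphic_tailEis hΓ j w Y) hmem]
    with z h1 h2 h3 h4 h5
  rw [h1, Pi.sub_apply, h2, Pi.smul_apply, h3, h4, h5, smul_eq_mul]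
  rfl

/-- **Expansion of a combination of the residuals**:
`Σⱼ gⱼ rⱼ(s) = (T_k - ĥ(s)) ι(Σⱼ gⱼ vⱼ(s)) + Σⱼ gⱼ srcⱼ(s)`. [folklore] -/
theorem sum_smul_rPart_some (i : Fin h) (g : Fin h → ℂ) (s : ℂ) :
    ∑ j, g j • rPart hΓ hneg hd hF σ κ Y i (some j) s =
      Tk hΓ hneg hd hF κ (((∑ j, g j • vPart hΓ hneg hd hF σ κ Y i (some j) s :
          pseudoCuspSubmodule hΓ hneg hd hF σ Y) : Lp ℂ 2 (volume.restrict F)))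
        - eigenvalueFn κ.k s • (((∑ j, g j • vPart hΓ hneg hd hF σ κ Y i (some j) s :
          pseudoCuspSubmodule hΓ hneg hd hF σ Y) : Lp ℂ 2 (volume.restrict F)))
        + ∑ j, g j • src Γ F σ κ Y i (some j) s := by
  simp only [rPart, Submodule.coe_sum, Submodule.coe_smul, map_sum, map_smul, Finset.smul_sum, smul_sub, smul_add,
    Finset.sum_add_distrib, Finset.sum_sub_distrib, smul_smul, mul_comm (g _)]

include hvol hinfty hper hineq hY in
/-- **The residuals `r₁(s₀), …, r_h(s₀)` are linearly independent.** If `Σⱼ gⱼ rⱼ(s₀) = 0`, then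
`u = ι(Σⱼ gⱼ vⱼ(s₀)) + Σⱼ gⱼ [θⱼ^{1-s₀}]` satisfies `T_k u = ĥ_k(s₀) u` in `L²(F)`; `ĥ_k(s₀)` being
non-real and `T_k` self-adjoint, `u = 0`; so `Σⱼ gⱼ [θⱼ^{1-s₀}] ∈ L²_Y`, whose constant terms above
`Y` are `g_m y^{1-s₀}` at `𝔞_m` — hence `g = 0`. [folklore] -/
theorem linearIndependent_rPart_baseParam (i : Fin h) :
    LinearIndependent ℂ (fun j => rPart hΓ hneg hd hF σ κ Y i (some j) baseParam) := by
  rw [Fintype.linearIndependent_iff]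
  intro g hg m
  set s₀ : ℂ := baseParam with hs₀
  set w₀ : ℂ := 1 - s₀ with hw₀
  have hw₀re : w₀.re ≤ 0 := by rw [hw₀, Complex.sub_re, Complex.one_re, hs₀, baseParam_re]; norm_num
  set μ₀ : ℂ := eigenvalueFn κ.k s₀ with hμ₀
  have hμ₀' : eigenvalueFn κ.k w₀ = μ₀ := by rw [hw₀, eigenvalueFn_one_sub]
  have hμ₀im : μ₀.im ≠ 0 := im_eigenvalueFn_baseParam_ne_zero κ
  set HY := pseudoCuspSubmodule hΓ hneg hd hF σ Y with hHY
  -- the combination `v'` and the tail classes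
  set v' : HY := ∑ j, g j • vPart hΓ hneg hd hF σ κ Y i (some j) s₀ with hv'
  have hmemθ : ∀ j, MemLp (tailEis Γ σ j w₀ Y) 2 (volume.restrict F) := fun j =>
    memLp_tailEis_of_re_nonpos hΓ hd hvol hper j hw₀re hY
  set θLp : Fin h → Lp ℂ 2 (volume.restrict F) := fun j => (hmemθ j).toLp _ with hθLp
  have hθ : ∀ j, Tk hΓ hneg hd hF κ (θLp j) - μ₀ • θLp j = src Γ F σ κ Y i (some j) s₀ := by
    intro j
    rw [← hμ₀']
    exact kernelCLM_tailEis_sub_smul hΓ hneg hd hF hvol hinfty hper hineq κ hY j (hmemθ j)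
  -- the eigen-relation for `u'`
  set u' : Lp ℂ 2 (volume.restrict F) := (v' : Lp ℂ 2 (volume.restrict F)) + ∑ j, g j • θLp j with hu'
  have hexp := sum_smul_rPart_some hΓ hneg hd hF (σ := σ) κ (Y := Y) i g s₀
  rw [hg] at hexp
  have heig : Tk hΓ hneg hd hF κ u' = μ₀ • u' := by
    have h1 : Tk hΓ hneg hd hF κ u' - μ₀ • u' =
        (Tk hΓ hneg hd hF κ (v' : Lp ℂ 2 (volume.restrict F)) - μ₀ • (v' : Lp ℂ 2 (volume.restrict F))) +
          ∑ j, g j • (Tk hΓ hneg hd hF κ (θLp j) - μ₀ • θLp j) := by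
      simp only [hu', map_add, map_sum, map_smul, smul_add, Finset.smul_sum, smul_sub, smul_smul, mul_comm μ₀,
        Finset.sum_sub_distrib]
      abel
    simp_rw [hθ] at h1
    rw [hv'] at h1
    have h2 : Tk hΓ hneg hd hF κ u' - μ₀ • u' = 0 := by rw [h1]; exact hexp.symm
    exact sub_eq_zero.mp h2
  -- `u' = 0`
  have hsa : IsSelfAdjoint (Tk hΓ hneg hd hF κ) := isSelfAdjoint_kernelCLM hΓ hneg hd hF κ.test κ.lip.continuous
  have hu0 : u' = 0 := eq_zero_of_apply_eq_smul_of_im_ne_zero hsa hμ₀im heig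
  -- hence `Σ gⱼ θⱼ ∈ L²_Y`
  have hΘmem : (∑ j, g j • θLp j) ∈ HY := by
    have e : ∑ j, g j • θLp j = -(v' : Lp ℂ 2 (volume.restrict F)) := by
      have := hu0
      rw [hu'] at this
      exact eq_neg_of_add_eq_zero_right this
    rw [e]
    exact HY.neg_mem (Submodule.coe_mem v')
  have hcusp := (mem_pseudoCuspSubmodule_iff hΓ hneg hd hF σ Y _).mp hΘmem m
  -- the constant term of `Σ gⱼ θⱼ` at `𝔞_m` above `Y` is `g_m y^{w₀}`
  set Θ : ℍ → ℂ := fun z => ∑ j, g j * tailEis Γ σ j w₀ Y z with hΘ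
  have hΘa : IsAutomorphic Γ Θ := by
    intro γ hγ z
    simp only [hΘ]
    refine Finset.sum_congr rfl fun j _ => ?_
    rw [isAutomorphic_tailEis hΓ j w₀ Y γ hγ z]
  have hcoe : (⇑(∑ j, g j • θLp j) : ℍ → ℂ) =ᵐ[volume.restrict F] Θ := by
    have h1 := Lp.coeFn_fun_finsetSum Finset.univ (fun j => g j • θLp j)
    have h2 : ∀ j, (⇑(g j • θLp j) : ℍ → ℂ) =ᵐ[volume.restrict F] fun z => g j * tailEis Γ σ j w₀ Y z := by
      intro j
      filter_upwards [Lp.coeFn_smul (g j) (θLp j), MemLp.coeFn_toLp (hmemθ j)] with z hz1 hz2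
      rw [hz1, Pi.smul_apply, hz2, smul_eq_mul]
    have h3 := ae_all_iff.mpr h2
    filter_upwards [h1, h3] with z hz1 hz3
    rw [hz1]
    exact Finset.sum_congr rfl fun j _ => hz3 j
  have hae : autExt Γ F (⇑(∑ j, g j • θLp j)) =ᵐ[volume] Θ :=
    (autExt_congr_ae hΓ hneg hd hF hcoe).trans (autExt_ae_eq_of_isAutomorphic hΓ hneg hd hF hΘa)
  have hmean : ∀ w : ℍ, Y < w.im → cuspMeanAt (σ m) Θ w = g m * ((w.im : ℝ) : ℂ) ^ w₀ := by
    intro w hw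
    have hw0 : 0 < w.im := w.im_pos
    have hconst : ∀ x : ℝ, Θ (σ m • ((x : ℝ) +ᵥ w)) = g m * ((w.im : ℝ) : ℂ) ^ w₀ := by
      intro x
      have e : (x : ℝ) +ᵥ w = ((x + w.re : ℝ)) +ᵥ UpperHalfPlane.ofComplex (⟨0, w.im⟩ : ℂ) := by
        conv_lhs => rw [← re_vadd_ofComplex_im w]
        rw [vadd_vadd]
      simp only [hΘ]
      rw [e]
      have hterm : ∀ j, g j * tailEis Γ σ j w₀ Y (σ m • (((x + w.re : ℝ)) +ᵥ UpperHalfPlane.ofComplex (⟨0, w.im⟩ : ℂ))) =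
          if j = m then g m * ((w.im : ℝ) : ℂ) ^ w₀ else 0 := by
        intro j
        rw [tailEis_def, incEisCusp_cutHigh_horocycle hΓ hneg hd hinfty hper hineq j m w₀ hY hw]
        split_ifs with hjm
        · subst hjm; rfl
        · rw [mul_zero]
      rw [Finset.sum_congr rfl fun j _ => hterm j, Finset.sum_ite_eq' Finset.univ m, if_pos (Finset.mem_univ m)]
    rw [cuspMeanAt_apply]
    simp_rw [hconst]
    rw [intervalIntegral.integral_const]; simp
  -- conclude: the set of heights `> Y` is not null
  by_contra hgm
  have hbad : ∀ᵐ w : ℍ, ¬(Y < w.im) := by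
    filter_upwards [hcusp, cuspMeanAt_congr_ae hae (σ m)] with w hw hw' hYw
    have h1 := hw hYw
    rw [hw', hmean w hYw] at h1
    rcases mul_eq_zero.mp h1 with h | h
    · exact hgm h
    · rw [Complex.cpow_eq_zero_iff] at h
      exact absurd h.1 (by rw [Complex.ofReal_eq_zero]; exact w.im_pos.ne')
  have hnull : volume {w : ℍ | Y < w.im} = 0 := by
    have := ae_iff.mp hbad
    simpa only [not_not] using this
  have hY0 : 0 < Y := by linarith
  have hpos : 0 < volume (cuspStrip Y) := by
    rw [volume_cuspStrip hY0]; exact ENNReal.ofReal_pos.mpr (by positivity)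
  have hsub : cuspStrip Y ⊆ {w : ℍ | Y < w.im} := fun w hw => hw.2.2
  have := measure_mono (μ := volume) hsub
  rw [hnull] at this
  exact absurd (le_antisymm this bot_le) hpos.ne'

include hvol hinfty hper hineq hY in
/-- **`det G(s₀) ≠ 0`** (a Gram determinant of linearly independent vectors). [folklore] -/
theorem det_gramM_baseParam_ne_zero (i : Fin h) : (gramM hΓ hneg hd hF σ κ Y i baseParam).det ≠ 0 := by
  have h := linearIndependent_rPart_baseParam hΓ hneg hd hF hvol hinfty hper hineq κ hY i
  rw [← Matrix.det_gram_ne_zero_iff_linearIndependent (𝕜 := ℂ)] at h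
  exact h

/-- **`ĥ_k(s)` is in the resolvent set of `T^Y_k` whenever it is non-real.** [folklore] -/
theorem eigenvalueFn_mem_resolventSet_of_im_ne_zero {s : ℂ} (hs : (eigenvalueFn κ.k s).im ≠ 0) :
    eigenvalueFn κ.k s ∈ resolventSet ℂ (TY hΓ hneg hd hF σ κ Y) :=
  mem_resolventSet_of_im_ne_zero (isSelfAdjoint_pseudoCuspKernelCLM hΓ hneg hd hF σ Y κ.test κ.lip.continuous) hs

/-- In particular at `s₀`. [folklore] -/
theorem eigenvalueFn_baseParam_mem_resolventSet :
    eigenvalueFn κ.k baseParam ∈ resolventSet ℂ (TY hΓ hneg hd hF σ κ Y) :=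
  eigenvalueFn_mem_resolventSet_of_im_ne_zero hΓ hneg hd hF κ (im_eigenvalueFn_baseParam_ne_zero κ)

include hvol hinfty hper hineq hY in
/-- **A neighbourhood of `s₀` on which everything is regular**: there is `ε > 0` such that for
`|s - s₀| < ε`: `s` is in the strip, `Re s > 1`, `ĥ_k(s)` is non-real (so in `ρ(T^Y_k)`), and
`det G(s) ≠ 0`. [folklore] -/
theorem exists_ball_baseParam (i : Fin h) :
    ∃ ε > 0, ∀ s ∈ ball baseParam ε, s ∈ κ.strip ∧ 1 < s.re ∧ (eigenvalueFn κ.k s).im ≠ 0 ∧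
      (gramM hΓ hneg hd hF σ κ Y i s).det ≠ 0 := by
  -- each condition is open at `s₀`
  have h1 : ∀ᶠ s in 𝓝 baseParam, s ∈ κ.strip := κ.isOpen_strip.mem_nhds (baseParam_mem_strip κ)
  have h2 : ∀ᶠ s in 𝓝 baseParam, 1 < s.re :=
    (isOpen_lt continuous_const Complex.continuous_re).mem_nhds one_lt_baseParam_re
  have h3 : ∀ᶠ s in 𝓝 baseParam, (eigenvalueFn κ.k s).im ≠ 0 :=
    ((Complex.continuous_im.comp (continuous_eigenvalueFn κ.test)).continuousAt).eventually_ne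
      (im_eigenvalueFn_baseParam_ne_zero κ)
  have h4 : ∀ᶠ s in 𝓝 baseParam, (gramM hΓ hneg hd hF σ κ Y i s).det ≠ 0 := by
    have hana : AnalyticAt ℂ (fun s => (gramM hΓ hneg hd hF σ κ Y i s).det) baseParam :=
      AnalyticAt.matrix_det fun m j => analyticAt_gramM_apply hΓ hneg hd hF hvol hinfty hper hineq κ hY
        (eigenvalueFn_baseParam_mem_resolventSet hΓ hneg hd hF κ) i m j
    exact hana.continuousAt.eventually_ne (det_gramM_baseParam_ne_zero hΓ hneg hd hF hvol hinfty hper hineq κ hY i)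
  obtain ⟨ε, hε, hball⟩ := Metric.eventually_nhds_iff_ball.mp (h1.and (h2.and (h3.and h4)))
  exact ⟨ε, hε, fun s hs => hball s hs⟩

end Independence

end Fuchsian

end Literature.NumberTheory.Automorphic
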